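import Summits.HodgeConjecture.HodgeConjecture.Theorems.F0P3cStCharTSPSIrredRegular          -- ★ p852743 (this seat) «PS-IRRED-REGULAR★» `cmWeylTorusCharPair_eq_of_ne_bot_ne_top`, `isIrreducible_cmPrincipalSeries_of_cmWeylTorusCharPair_ne`; brings ★ `cmTorusCharPair`, `conjInvChar`, `glDiagonal_mem_unitaryGroupOfForm_antidiagonal_iff`
import HarnessLib

/-!
# F0 · P3c · line LH6 «StCharTS» — «W-FIXED ⟺ TRIVIAL ON NORMS★»: `w(χ₁, χ₂) = (χ₁, χ₂)` iff `χ₁(ᾱ α) = 1` for all `α`; hence a REDUCIBLE unitary `i_G(χ₁, χ₂)` of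
# `U(Φ₃)(L⁺_v)` has `χ₁|_{N E_v^×} = 1`, and `i_G(χ₁, χ₂)` is IRREDUCIBLE as soon as `χ₁(ᾱ α) ≠ 1` for one `α` [Rogawski1990 §12.1 p. 171, §12.2 p. 173; Casselman1995 Thm. 6.6.1; Keys1984 §7]

Cell `pub/hodgecm-mathlib`, crux H413 = `stmt-HodgeConjecture-24833` (lane `--supports … --as helper`), route HCCMUnconditional; seat F0P2-p06 (g20), FILE 4 (the print-vocabulary
reading of ★ FILE 3 «PS-IRRED-REGULAR★» p852743).  THEOREMS ONLY; ★-only imports.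

WHAT.  For the pair characters of the diagonal torus `T = {d(α, β, ᾱ⁻¹)}` of `U(σ, Φ₃)(R)` (★ `torusCharPair σ Φ₃ _ 0 χ₁ χ₂ : d ↦ χ₁(α) χ₂(det d)`, its Weyl conjugate ★
`weylTorusCharPair = (χ̄₁⁻¹, χ₂)`), `σ` an involution:
* §1 (generic) **`weylTorusCharPair_eq_iff`**: `w(χ₁, χ₂) = (χ₁, χ₂) ↔ ∀ α, χ₁(σ α) · χ₁(α) = 1` («`χ₁` is trivial on the norms `ᾱ α`»); evaluate at the section `α ↦ d(α, ᾱ α⁻¹, ᾱ⁻¹)` (`det = 1`)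
  of ★ `F0P2pTorusPairsAndVacuity`; and **`weylTorusCharPair_eq_of_apply_fixed_eq_one`**: `χ₁|_{R^σ} = 1 ⇒ w(χ₁, χ₂) = (χ₁, χ₂)` (norms are `σ`-fixed) — the semi-regular point
  of RUNG 0's `hKeysRed3` ∕ case (3) IS `w`-fixed.
* §2 (CM, `v` non-split, `χ₁, χ₂` continuous, `|χ₁| = 1`) **`apply_conj_mul_eq_one_of_ne_bot_ne_top`**: a reducible `i_G(χ₁, χ₂)` has `χ₁(ᾱ α) = 1` for every `α ∈ E_v^×` (★ FILE 3 + §1), and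
  **`isIrreducible_cmPrincipalSeries_of_apply_conj_mul_ne_one`**: `χ₁(ᾱ α) ≠ 1` for one `α` ⇒ `i_G(χ₁, χ₂)` irreducible (Bruhat, print's «regular» hypothesis in the words of
  [Rogawski1990 §12.2]: `χ₁ ≠ χ̄₁⁻¹`).  READING for RUNG 0's `hKeysRed` (★ `F0P3cStCharTSRung0Eight` :131) at UNITARY parameters: its cases (2) `χ₁ = η‖·‖^{±1/2}` and (1) are non-unitary, so
  the list says «reducible unitary ⇒ `χ₁|_{F×} = 1`, `χ₁ ≠ 1`»; in house we now have «reducible unitary ⇒ `χ₁|_{N E×} = 1`»; the gap is print's analytic part (`χ₁|_{F×} = ω` unitary and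
  `χ₁ = 1` are irreducible [Keys1984 §7]) — not claimed.
HONEST LABEL: HC_CM is proved only modulo the 7 printed citations (2 remaining named inputs: hLiu418 = `stmt-HodgeConjecture-24832`, h413 = `stmt-HodgeConjecture-24833`) until rung 0 closes;
count-neutral (no named input is re-lettered).

## References
* [Rogawski1990] J. D. Rogawski, *Automorphic Representations of Unitary Groups in Three Variables*, Ann. of Math. Stud. 123 (1990), §12.1 p. 171 (`χ(d) = χ₁(α) χ₂(det d)`), §12.2 p. 173
  («`w(χ₁, χ₂) = (χ̄₁⁻¹, χ₂)`»; Keys' list).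
* [Casselman1995] W. Casselman, *Introduction to the theory of admissible representations of p-adic reductive groups* (1995), §6.6 Thm. 6.6.1 (Bruhat) pp. 65–66.
* [Keys1984] D. Keys, *Principal series representations of special unitary groups over local fields*, Compositio Math. 51 (1984), §7 Thm. p. 126.
-/

set_option autoImplicit false
-- the mandated namespace has the single-problem summit's repeated segment (`HodgeConjecture.HodgeConjecture`)
set_option linter.dupNamespace false

noncomputable section

open NumberField IsDedekindDomain
open scoped Matrix
open Literature.NumberTheory.Rogawski1990 Literature.NumberTheory.Automorphic Literature.NumberTheory.Automorphic.UnitaryGroup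

namespace Summit.HodgeConjecture.HodgeConjecture.Cruxes.H413.F0P3cStCharTSWeylFixedIffNormTrivial

/-! ## §1 Generic torus algebra for `U(σ, Φ₃)(R)`: `w`-fixed ⟺ trivial on norms -/

section Generic

variable {R : Type*} [CommRing R] (σ : R →+* R)

/-- **The section `α ↦ d(α, ᾱ α⁻¹, ᾱ⁻¹)` of the diagonal torus of `U(σ, Φ₃)(R)`** (★ `F0P2pTorusPairsAndVacuity`'s `d₁`; `det = 1`): for every unit `α` there is `t ∈ T` with
`t₀₀ = α` on which `(χ₁, χ₂)` takes the value `χ₁(α)` and `w(χ₁, χ₂)` the value `χ₁(σ α)⁻¹`, for ALL `χ₁, χ₂`. [cite: Rogawski1990, §12.1 p. 171; §12.2 p. 173] -/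
theorem exists_torus_apply_eq (hσ : ∀ x : R, σ (σ x) = x) (J₃ : Matrix (Fin 3) (Fin 3) R) (hJ : J₃ = (StdForm.antidiagonal 3).over R) (α : Rˣ) :
    ∃ t : ↥(torusU σ J₃), ∀ (χ₁ : Rˣ →* ℂˣ) (χ₂ : ↥(normOneUnits σ) →* ℂˣ),
      torusCharPair σ J₃ hJ 0 χ₁ χ₂ t = χ₁ α ∧ weylTorusCharPair σ J₃ hJ 0 χ₁ χ₂ t = (χ₁ (Units.map (σ : R →* R) α))⁻¹ := by
  subst hJ
  have hσu : ∀ u : Rˣ, Units.map (σ : R →* R) (Units.map (σ : R →* R) u) = u := fun u => Units.ext (hσ u)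
  have hσv : ∀ u : Rˣ, σ (u : R) = ((Units.map (σ : R →* R) u : Rˣ) : R) := fun u => rfl
  let d₁ : Fin 3 → Rˣ := ![α, Units.map (σ : R →* R) α * α⁻¹, (Units.map (σ : R →* R) α)⁻¹]
  have hd₁ : glDiagonal 3 R d₁ ∈ unitaryGroupOfForm σ ((StdForm.antidiagonal 3).over R) := by
    rw [glDiagonal_mem_unitaryGroupOfForm_antidiagonal_iff]
    intro i
    fin_cases i
    · show σ (((Units.map (σ : R →* R) α)⁻¹ : Rˣ) : R) * (α : R) = 1
      rw [hσv, map_inv, hσu, Units.inv_mul]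
    · show σ ((Units.map (σ : R →* R) α * α⁻¹ : Rˣ) : R) * ((Units.map (σ : R →* R) α * α⁻¹ : Rˣ) : R) = 1
      rw [hσv, map_mul, map_inv, hσu, ← Units.val_mul, mul_assoc, inv_mul_cancel_left, mul_inv_cancel, Units.val_one]
    · show σ ((α : Rˣ) : R) * (((Units.map (σ : R →* R) α)⁻¹ : Rˣ) : R) = 1
      rw [hσv, Units.mul_inv]
  let t₁ : ↥(torusU σ ((StdForm.antidiagonal 3).over R)) := ⟨⟨glDiagonal 3 R d₁, hd₁⟩, ⟨d₁, rfl⟩⟩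
  have hprod : (⟨∏ j, d₁ j, by
      rw [← torusDet_eq_of_glDiagonal_eq σ _ t₁ d₁ rfl]; exact torusDet_mem_normOneUnits σ _ rfl t₁⟩ : ↥(normOneUnits σ)) = 1 := by
    apply Subtype.ext
    show ∏ j, d₁ j = 1
    rw [Fin.prod_univ_three]
    show α * (Units.map (σ : R →* R) α * α⁻¹) * (Units.map (σ : R →* R) α)⁻¹ = 1
    rw [mul_comm (Units.map (σ : R →* R) α) α⁻¹, ← mul_assoc, mul_inv_cancel, one_mul, mul_inv_cancel]
  refine ⟨t₁, fun χ₁ χ₂ => ⟨?_, ?_⟩⟩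
  · rw [torusCharPair_apply_of_glDiagonal_eq σ _ rfl 0 χ₁ χ₂ t₁ d₁ rfl, hprod, map_one, mul_one]
    rfl
  · rw [weylTorusCharPair_eq, torusCharPair_apply_of_glDiagonal_eq σ _ rfl 0 (conjInvChar σ χ₁) χ₂ t₁ d₁ rfl, hprod, map_one, mul_one,
      conjInvChar_apply]
    rfl

/-- **«W-FIXED ⟺ TRIVIAL ON NORMS»**: for an involution `σ`, `w(χ₁, χ₂) = (χ₁, χ₂)` on the torus of `U(σ, Φ₃)(R)` iff `χ₁(σ α) · χ₁(α) = 1` for every unit `α` (i.e. `χ̄₁⁻¹ = χ₁`, `χ₁`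
trivial on the norms `ᾱ α`). [cite: Rogawski1990, §12.2 p. 173] -/
theorem weylTorusCharPair_eq_iff (hσ : ∀ x : R, σ (σ x) = x) (J₃ : Matrix (Fin 3) (Fin 3) R) (hJ : J₃ = (StdForm.antidiagonal 3).over R)
    (χ₁ : Rˣ →* ℂˣ) (χ₂ : ↥(normOneUnits σ) →* ℂˣ) :
    weylTorusCharPair σ J₃ hJ 0 χ₁ χ₂ = torusCharPair σ J₃ hJ 0 χ₁ χ₂ ↔ ∀ α : Rˣ, χ₁ (Units.map (σ : R →* R) α) * χ₁ α = 1 := by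
  constructor
  · intro h α
    obtain ⟨t, ht⟩ := exists_torus_apply_eq σ hσ J₃ hJ α
    obtain ⟨h1, h2⟩ := ht χ₁ χ₂
    have h3 : (χ₁ (Units.map (σ : R →* R) α))⁻¹ = χ₁ α := by rw [← h2, h, h1]
    rw [← h3, mul_inv_cancel]
  · intro h
    ext t
    rw [weylTorusCharPair_apply, torusCharPair_apply]
    congr 2
    rw [inv_eq_iff_mul_eq_one, Units.ext_iff, Units.val_mul, Units.val_one]
    exact congrArg Units.val (h (torusEntry σ J₃ 0 t))

/-- **The semi-regular point is `w`-fixed**: if `χ₁` is trivial on the `σ`-fixed units (`χ₁|_{F×} = 1` — the hypothesis shape of RUNG 0's `hKeysRed3` ∕ Keys' case (3)) then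
`w(χ₁, χ₂) = (χ₁, χ₂)` (the norms `ᾱ α` are `σ`-fixed). [cite: Rogawski1990, §12.2 (3) p. 173] -/
theorem weylTorusCharPair_eq_of_apply_fixed_eq_one (hσ : ∀ x : R, σ (σ x) = x) (J₃ : Matrix (Fin 3) (Fin 3) R) (hJ : J₃ = (StdForm.antidiagonal 3).over R)
    (χ₁ : Rˣ →* ℂˣ) (χ₂ : ↥(normOneUnits σ) →* ℂˣ) (htriv : ∀ a : Rˣ, σ (a : R) = a → χ₁ a = 1) :
    weylTorusCharPair σ J₃ hJ 0 χ₁ χ₂ = torusCharPair σ J₃ hJ 0 χ₁ χ₂ := by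
  rw [weylTorusCharPair_eq_iff σ hσ J₃ hJ]
  intro α
  rw [← map_mul]
  refine htriv _ ?_
  show σ (((Units.map (σ : R →* R) α * α : Rˣ)) : R) = ((Units.map (σ : R →* R) α * α : Rˣ) : R)
  rw [Units.val_mul, map_mul]
  show σ (σ (α : R)) * σ (α : R) = σ (α : R) * (α : R)
  rw [hσ, mul_comm]

end Generic

/-! ## §2 The CM reading: reducible unitary ⇒ trivial on norms; non-trivial on one norm ⇒ irreducible -/

section CM

variable (L : Type) [Field L] [NumberField L] [IsCMField L] (v : HeightOneSpectrum (𝓞 ↥(maximalRealSubfield L)))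
  (hns : ∀ w : PlacesOver L v, IsCMField.complexConj L • w.1 = w.1)

/-- **`wχ = χ` ⟺ `χ₁(ᾱ α) = 1` for all `α`** on the torus of `U(Φ₃)(L⁺_v)` (★ `cmWeylTorusCharPair`, ★ `cmTorusCharPair`; `c ⊗ 1` is an involution, ★ `conjLocal_conjLocal_cm`).
[cite: Rogawski1990, §12.2 p. 173] -/
theorem cmWeylTorusCharPair_eq_iff (χ₁ : (LocalRing L v)ˣ →* ℂˣ) (χ₂ : ↥(normOneUnits (conjLocal L (IsCMField.complexConj L) v)) →* ℂˣ) :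
    cmWeylTorusCharPair L v χ₁ χ₂ = cmTorusCharPair L v χ₁ χ₂ ↔
      ∀ α : (LocalRing L v)ˣ, χ₁ (Units.map (conjLocal L (IsCMField.complexConj L) v : LocalRing L v →* LocalRing L v) α) * χ₁ α = 1 :=
  weylTorusCharPair_eq_iff (conjLocal L (IsCMField.complexConj L) v) (conjLocal_conjLocal_cm L v) (cmLocalForm L 3 v) (cmLocalForm_eq_over L 3 v) χ₁ χ₂

/-- **The semi-regular CM point is `w`-fixed**: `χ₁|_{F_v^×} = 1 ⇒ cmWeylTorusCharPair L v χ₁ χ₂ = cmTorusCharPair L v χ₁ χ₂`. [cite: Rogawski1990, §12.2 (3) p. 173] -/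
theorem cmWeylTorusCharPair_eq_of_apply_fixed_eq_one (χ₁ : (LocalRing L v)ˣ →* ℂˣ) (χ₂ : ↥(normOneUnits (conjLocal L (IsCMField.complexConj L) v)) →* ℂˣ)
    (htriv : ∀ a : (LocalRing L v)ˣ, (conjLocal L (IsCMField.complexConj L) v) (a : LocalRing L v) = a → χ₁ a = 1) :
    cmWeylTorusCharPair L v χ₁ χ₂ = cmTorusCharPair L v χ₁ χ₂ :=
  weylTorusCharPair_eq_of_apply_fixed_eq_one (conjLocal L (IsCMField.complexConj L) v) (conjLocal_conjLocal_cm L v) (cmLocalForm L 3 v)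
    (cmLocalForm_eq_over L 3 v) χ₁ χ₂ htriv

include hns in
set_option synthInstance.maxHeartbeats 400000 in
set_option maxHeartbeats 4000000 in
-- statement-heavy: the `SmoothInd` carrier of `cmPrincipalSeries` (class of ★ PS-IRRED-REGULAR §3)
/-- **A REDUCIBLE unitary `i_G(χ₁, χ₂)` has `χ₁` TRIVIAL ON NORMS**: at a non-split `v`, for continuous `χ₁, χ₂` with `|χ₁| = 1`, a `G`-stable `⊥ ≠ N ≠ ⊤` in `i_G(χ₁, χ₂)` forces
`χ₁(ᾱ α) = 1` for every `α ∈ E_v^×` (★ FILE 3 `cmWeylTorusCharPair_eq_of_ne_bot_ne_top` + §1) — the in-house unitary half of the direction «reducible ⇒ on Keys' list».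
[cite: Casselman1995, §6.6 Thm. 6.6.1 (Bruhat) pp. 65–66] [cite: Rogawski1990, §12.2 p. 173] [cite: Keys1984, §7 Thm. p. 126] -/
theorem apply_conj_mul_eq_one_of_ne_bot_ne_top
    (χ₁ : (LocalRing L v)ˣ →* ℂˣ) (χ₂ : ↥(normOneUnits (conjLocal L (IsCMField.complexConj L) v)) →* ℂˣ)
    (h1 : Continuous fun x => ((χ₁ x : ℂˣ) : ℂ)) (h2 : Continuous fun x => ((χ₂ x : ℂˣ) : ℂ)) (hχ₁u : ∀ x, ‖((χ₁ x : ℂˣ) : ℂ)‖ = 1)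
    (hred : ∃ N : Subrepresentation (cmPrincipalSeries L 3 v (cmTorusCharPair L v χ₁ χ₂)), N ≠ ⊥ ∧ N ≠ ⊤)
    (α : (LocalRing L v)ˣ) :
    χ₁ (Units.map (conjLocal L (IsCMField.complexConj L) v : LocalRing L v →* LocalRing L v) α) * χ₁ α = 1 :=
  (cmWeylTorusCharPair_eq_iff L v χ₁ χ₂).1 (F0P3cStCharTSPSIrredRegular.cmWeylTorusCharPair_eq_of_ne_bot_ne_top L v hns χ₁ χ₂ h1 h2 hχ₁u hred) α

include hns in
set_option synthInstance.maxHeartbeats 400000 in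
set_option maxHeartbeats 4000000 in
-- statement-heavy: the `SmoothInd` carrier of `cmPrincipalSeries` (class of ★ PS-IRRED-REGULAR §3)
/-- **Bruhat in print's words**: at a non-split `v`, for continuous `χ₁, χ₂` with `|χ₁| = 1` and `χ₁(ᾱ α) ≠ 1` for SOME `α` (`χ₁ ≠ χ̄₁⁻¹`: «`χ` regular»), the unitary principal series
`i_G(χ₁, χ₂)` of `U(Φ₃)(L⁺_v)` is IRREDUCIBLE (★ FILE 3 + §1). [cite: Casselman1995, §6.6 Thm. 6.6.1 (Bruhat) pp. 65–66] [cite: Rogawski1990, §12.2 p. 173] -/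
theorem isIrreducible_cmPrincipalSeries_of_apply_conj_mul_ne_one
    (χ₁ : (LocalRing L v)ˣ →* ℂˣ) (χ₂ : ↥(normOneUnits (conjLocal L (IsCMField.complexConj L) v)) →* ℂˣ)
    (h1 : Continuous fun x => ((χ₁ x : ℂˣ) : ℂ)) (h2 : Continuous fun x => ((χ₂ x : ℂˣ) : ℂ)) (hχ₁u : ∀ x, ‖((χ₁ x : ℂˣ) : ℂ)‖ = 1)
    (hα : ∃ α : (LocalRing L v)ˣ, χ₁ (Units.map (conjLocal L (IsCMField.complexConj L) v : LocalRing L v →* LocalRing L v) α) * χ₁ α ≠ 1) :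
    (cmPrincipalSeries L 3 v (cmTorusCharPair L v χ₁ χ₂)).IsIrreducible := by
  obtain ⟨α, hα⟩ := hα
  exact F0P3cStCharTSPSIrredRegular.isIrreducible_cmPrincipalSeries_of_cmWeylTorusCharPair_ne L v hns χ₁ χ₂ h1 h2 hχ₁u
    fun h => hα ((cmWeylTorusCharPair_eq_iff L v χ₁ χ₂).1 h α)

end CM

end Summit.HodgeConjecture.HodgeConjecture.Cruxes.H413.F0P3cStCharTSWeylFixedIffNormTrivial

end
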